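import Mathlib
import HarnessLib
import Literature.AlgebraicGeometry.Resolution.BlowupPrincipalCharts

/-!
# S1a — the coordinate ring of a principal chart: `Γ(X', X'[U,b]) ≅ (Rees I(U))_{(bt)}` with its pin

[OURS · L1 W4.5c · lead-1 g6] — NOT a statement of the manuscript; counted 0; AI-level work, weaker than expert
review. Crux stmt-ResolutionOfSingularities-17941 (`WildQuotients.CyclicQuotientFourfolds`), line `s1a-logminvertex`,
stub `stub_localGame` (producer); A5b design (N3)/(S2) «node data on the principal charts». For a blow-up
`π : X' ⟶ X` of `I`, an affine open `U ⊆ X` and `b ∈ I(U)`, the treeʼs intrinsic principal chart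
`blowupChart π I U b` (`Literature/…/BlowupPrincipalCharts.lean`) has coordinate ring the blow-up chart ring
`HomogeneousLocalization.Away (reesGrading (I.ideal U)) (reesT b hb)` (Stacks 0804 `A[I/b]`), and the iso sends the
pulled-back section `π^* s`, `s ∈ Γ(X, U)`, to `s/1 = reesChartBase b hb s`:

* **`exists_ringEquiv_blowupChart`** — `∃ Ψ : Γ(X', blowupChart π I U b) ≃+* (Rees I(U))_{(bt)}, ∀ s,
  Ψ (π.appLE U _ _ s) = reesChartBase b hb s` (assembled from `IsBlowup.exists_chartImmersion`,
  `IsBlowup.blowupChart_eq_image`, `appIso_hom_appLE_chartImmersion`, `affineBlowup.appIso_hom_pull`).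
With `…S1aChartNodeData.exists_chartNodeData` (over `𝒜 0`) and a transport along the node iso this gives the node
data of the new charts; the pin is what the intertwining computation ((S3), lifted `g₀` vs `sigmaChart`) consumes.
-/

set_option linter.dupNamespace false

noncomputable section

open CategoryTheory AlgebraicGeometry TopologicalSpace
open Literature.AlgebraicGeometry.Resolution

namespace Summit.ResolutionOfSingularities.ResolutionOfSingularities.Theorems.WildQuotientResolution.S1.BlowupCharts

universe u

variable {X' X : Scheme.{u}} {π : X' ⟶ X} {I : X.IdealSheafData} (hπ : IsBlowup π I) (U : X.affineOpens)
  (b : Γ(X, U)) (hb : b ∈ I.ideal U)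

include hπ in
/-- **The coordinate ring of the principal chart `X'[U, b]`** is the blow-up chart ring `(Rees I(U))_{(bt)}`, the
pull-back of `s ∈ Γ(X, U)` corresponding to `s/1`. [OURS · L1 W4.5c] -/
theorem exists_ringEquiv_blowupChart :
    ∃ Ψ : Γ(X', blowupChart π I U b) ≃+* HomogeneousLocalization.Away (reesGrading (I.ideal U)) (reesT b hb),
      ∀ s : Γ(X, U), Ψ (π.appLE U (blowupChart π I U b) (blowupChart_le_preimage π I U b) s) =
        reesChartBase b hb s := by
  obtain ⟨φ, _, hφ, hrange⟩ := hπ.exists_chartImmersion U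
  have hW : blowupChart π I U b = φ ''ᵁ affineBlowup.chartOpen b hb := hπ.blowupChart_eq_image φ hφ hrange b hb
  have hle : φ ''ᵁ (affineBlowup.chartOpen b hb : (affineBlowup (I.ideal U)).Opens) ≤ π ⁻¹ᵁ (U : X.Opens) := by
    rw [← hW]; exact blowupChart_le_preimage π I U b
  -- the chain of isomorphisms `Γ(X', X'[U,b]) ≅ Γ(X', φ(D₊)) ≅ Γ(Bl, D₊) ≅ Γ(Spec A[I/b], ⊤) ≅ A[I/b]`
  obtain ⟨Ψ, hΨ⟩ : ∃ Ψ : Γ(X', blowupChart π I U b) ≃+*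
      HomogeneousLocalization.Away (reesGrading (I.ideal U)) (reesT b hb),
      ∀ t, Ψ t = (Scheme.ΓSpecIso (.of (HomogeneousLocalization.Away (reesGrading (I.ideal U)) (reesT b hb)))).hom
        (((affineBlowup.chartι (I := I.ideal U) b hb).appIso ⊤).hom
          ((φ.appIso (affineBlowup.chartOpen b hb : (affineBlowup (I.ideal U)).Opens)).hom
            (X'.presheaf.map (eqToHom (congrArg Opposite.op hW)) t))) :=
    ⟨(X'.presheaf.mapIso (eqToIso (congrArg Opposite.op hW)) ≪≫
        φ.appIso (affineBlowup.chartOpen b hb : (affineBlowup (I.ideal U)).Opens) ≪≫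
        (affineBlowup.chartι (I := I.ideal U) b hb).appIso ⊤ ≪≫
        Scheme.ΓSpecIso (.of (HomogeneousLocalization.Away (reesGrading (I.ideal U)) (reesT b hb)))
        ).commRingCatIsoToRingEquiv, fun _ => rfl⟩
  refine ⟨Ψ, fun s => ?_⟩
  have h1 : X'.presheaf.map (eqToHom (congrArg Opposite.op hW))
      (π.appLE U (blowupChart π I U b) (blowupChart_le_preimage π I U b) s) =
      π.appLE U (φ ''ᵁ affineBlowup.chartOpen b hb) hle s := by
    have := Scheme.Hom.appLE_map π (blowupChart_le_preimage π I U b) (eqToHom (congrArg Opposite.op hW))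
    exact (congrArg (fun f : Γ(X, U) ⟶ Γ(X', φ ''ᵁ affineBlowup.chartOpen b hb) => f s) this :)
  have h2 := appIso_hom_appLE_chartImmersion φ hφ b hb hle s
  have h3 := affineBlowup.appIso_hom_pull (I := I.ideal U) b hb s
  have h4 : ∀ z, (Scheme.ΓSpecIso (.of (HomogeneousLocalization.Away (reesGrading (I.ideal U)) (reesT b hb)))).hom
      ((Scheme.ΓSpecIso (.of (HomogeneousLocalization.Away (reesGrading (I.ideal U)) (reesT b hb)))).inv z) = z :=
    fun z => by rw [← CommRingCat.comp_apply, Iso.inv_hom_id]; rfl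
  rw [hΨ]
  simp only [h1, h2, h3, h4]

end Summit.ResolutionOfSingularities.ResolutionOfSingularities.Theorems.WildQuotientResolution.S1.BlowupCharts

end
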